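import Mathlib
import Summits.ResolutionOfSingularities.ResolutionOfSingularities.Theorems.WeightedInvariantLocalWeightedDropPureDescentBridge

/-!
# `WeightedInvariant.LocalWeightedDrop`, registered stub S3πM `stub_wildPurelyInseparableReductionWon` — CLOSED BY NAME by the pure-power polyhedron descent

Crux item stmt-ResolutionOfSingularities-8899 `LocalWeightedDrop` (route `ResolutionOfSingularities/WeightedInvariant`), registered skeleton v29
(4058ce51dfd2e5c8).  [OURS · L1 W4.3, chain w43, lead prover (gen 3).  Nothing here is a statement of any manuscript.]

THE REGISTERED STUB S3πM, name and signature VERBATIM (skeleton drafts v22–v29; stub worker 1's class cut, evidence #53 on stmt-8899): over an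
algebraically closed field of characteristic `p`, for `d = p^e > 2`, GIVEN the singular germs in `≤ 2` variables, the singular surface germs of order `< d`,
the order-`d` surface germs whose degree-`d` form has a one-dimensional apex, and the terminal purely inseparable forms, EVERY purely inseparable surface
form `y^d + A₀(x₁,x₂)` with `ord A₀ > d` is won in the local weighted resolution game.  PROOF: `PureDescent.purelyInseparableFormWon` (the pure-power
polyhedron descent = Cossart–Jannsen–Saito's surface algorithm for `J = (y^q + A₀)`, `e = 2`, read on the coefficient `A₀` modulo `q`-th powers: files
`…PureDescentDefs/Newton/ShearBeta/NoChain/BridgeTools/Bridge`); of the four hypotheses only (H<d) and (Haxis) are used — the `≤ 2`-variable germs and the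
terminal forms are not needed by this key.  With S3πT (`stub_wildPurelyInseparableTerminalWon`, p482800) and S3ρ this closes S3 `wildUnaryConeSurfaceWon`
of the skeleton (`wildUnaryConeSurfaceWon_of_classKeys`, p487612).
-/

set_option linter.dupNamespace false -- mandated namespace of this single-conjunct summit

namespace Summit.ResolutionOfSingularities.ResolutionOfSingularities.Theorems

open Literature.AlgebraicGeometry.Resolution

/-- S3πM — THE PURELY INSEPARABLE SURFACE FORMS `y^{p^e} + A₀(x₁,x₂)` ARE WON (registered stub of skeleton v29, statement VERBATIM) [OURS · L1 W4.3].
Over an algebraically closed field of characteristic `p`, for `d = p^e > 2`, given the singular surface germs of order `< d` and the order-`d` germs with a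
one-dimensional apex (the other two hypotheses are not used), every `y^d + A₀` with `ord A₀ > d` is won: `PureDescent.purelyInseparableFormWon`. -/
theorem stub_wildPurelyInseparableReductionWon : ∀ (p : ℕ), p.Prime → ∀ (k : Type) [Field k] [CharP k p] [IsAlgClosed k],
      (∀ m : ℕ, m < 3 → ∀ g : MvPowerSeries (Fin m) k,
        CobordantGame.IsSingular k g → CobordantGame.Won k m g) →
      ∀ (d : ℕ), (∃ e : ℕ, d = p ^ e) → 2 < d →
      (∀ g : MvPowerSeries (Fin 3) k, CobordantGame.IsSingular k g → g.order < d →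
        CobordantGame.Won k 3 g) →
      (∀ g : MvPowerSeries (Fin 3) k, CobordantGame.IsSingular k g → g.order = d →
        (∃ c : Fin 3 → k, c ≠ 0 ∧ ∀ v : Fin 3 → k,
          CobordantChart.initEval (fun _ : Fin 3 => 1) (v + c) d g =
            CobordantChart.initEval (fun _ : Fin 3 => 1) v d g) →
        (∀ c₁ c₂ : Fin 3 → k,
          (∀ v : Fin 3 → k, CobordantChart.initEval (fun _ : Fin 3 => 1) (v + c₁) d g =
            CobordantChart.initEval (fun _ : Fin 3 => 1) v d g) →
          (∀ v : Fin 3 → k, CobordantChart.initEval (fun _ : Fin 3 => 1) (v + c₂) d g =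
            CobordantChart.initEval (fun _ : Fin 3 => 1) v d g) →
          ∃ α β : k, (α ≠ 0 ∨ β ≠ 0) ∧ α • c₁ + β • c₂ = 0) →
        CobordantGame.Won k 3 g) →
      (∀ (A₀ : MvPowerSeries (Fin 2) k), (d : ℕ∞) < A₀.order →
        ((∃ (r s : ℕ) (U : MvPowerSeries (Fin 2) k), MvPowerSeries.constantCoeff U ≠ 0 ∧ ¬ (d ∣ r ∧ d ∣ s) ∧
            A₀ = MvPowerSeries.X (0 : Fin 2) ^ r * MvPowerSeries.X (1 : Fin 2) ^ s * U) ∨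
          (∃ (i : Fin 2) (m : ℕ) (g : MvPowerSeries (Fin 2) k), 0 < m ∧ 0 < g.order ∧ g.order < d ∧
            A₀ = MvPowerSeries.X i ^ (d * m) * g)) →
        CobordantGame.Won k 3 (MvPowerSeries.X (Fin.last 2) ^ d +
          MvPowerSeries.rename (Fin.succAboveEmb (Fin.last 2)) A₀)) →
      ∀ (A₀ : MvPowerSeries (Fin 2) k), (d : ℕ∞) < A₀.order →
        CobordantGame.Won k 3 (MvPowerSeries.X (Fin.last 2) ^ d +
          MvPowerSeries.rename (Fin.succAboveEmb (Fin.last 2)) A₀) := by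
  intro p hp k _ _ _ _ d hd _ hord haxis _ A₀ hA₀
  obtain ⟨e, rfl⟩ := hd
  exact PureDescent.purelyInseparableFormWon p hp k e hord haxis A₀ hA₀

end Summit.ResolutionOfSingularities.ResolutionOfSingularities.Theorems
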